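/-
Copyright (c) 2026. All rights reserved.
Released under Apache 2.0 license as described in the file LICENSE.
Authors: abc-iut cell — seat abc-iut-w4-d104 (gen 5): the points-level semi-abelian datum for [AbsTopIII] Def 1.5
(L4-lead 2026-08-26T13:06:46Z: «HONESTLY-LABELLED hypothesis package», first refusal abc-iut-L4-t1).
-/
import Literature.AnabelianGeometry.AbsoluteAnabelian.AbsTopIII.KummerFaithfulDevissageProofs
import Literature.AnabelianGeometry.AbsoluteAnabelian.AbsTopIII.KummerFaithfulBaseChangeProofs
import HarnessLib

/-!
# [AbsTopIII] Def. 1.5, the semi-abelian case AT THE LEVEL OF POINTS: a hypothesis package and its discharge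

S. Mochizuki, *Topics in Absolute Anabelian Geometry III*, §1, Def. 1.5 p. 32 (lit key
`paper:url-5493eb38cbb7`): `k` is Kummer-faithful if for every finite extension `k_H` of `k` and every
SEMI-ABELIAN variety `A` over `k_H`, (a) `⋂_{N ≥ 1} N · A(k_H) = {0}`.  The tree predicate
`IsKummerFaithful` (KummerFaithful.lean) types the torus and abelian-variety cases; its TODO(general form)
— "an extension `0 → T → A → B → 0` reduces to the two cases when `B(k_H)` has finite torsion" — has its
ALGEBRA half in the tree (`DivisibleElementsTrivial.of_extension_of_finite_torsion`,
KummerFaithfulDevissageProofs.lean).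

HONEST LABEL.  The tree has no semi-abelian varieties as `k_H`-group schemes (abelian varieties are genuine
group schemes, `Motives.AbelianVariety`; the split torus `Motives.splitTorusOver` is typed as a SCHEME only —
typing debt «E-L4-11 SemiAbelianGroupScheme» of the abc-iut L4 ledger).  Since condition (a) speaks only about
the GROUP `A(k_H)`, this file records the semi-abelian case by the data it induces on points — a HYPOTHESIS
PACKAGE, the «shadow of the semi-abelian case», NOT a definition of semi-abelian varieties:

* `SemiAbelianPointsDatum k' P B` — on a commutative group `P` ("`A(k')`") and an abelian variety `B / k'`
  (the abelian quotient): a homomorphism `P →* B(k')` whose kernel ("`T(k')`", the torus part;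
  `0 → T(k') → A(k') → B(k')` is exact) embeds into `(Lˣ)^r` for some finite extension `L / k'` splitting the
  torus (an `∃`-clause: no instance is declared).
  A genuine semi-abelian variety `0 → T → A → B → 0` over `k'` inhabits it (left exactness of `k'`-points,
  `T_L ≅ 𝔾ₘ^r`); so does every abelian variety (`ofAbelianVariety`, torus part trivial).
* `SemiAbelianPointsDatum.divisibleElementsTrivial_of_isKummerFaithful` — for `k` Kummer-faithful (tree
  predicate), `k'/k` finite and `B(k')` with FINITE torsion subgroup, the group `P` satisfies (a): one line
  from the dévissage + `IsTorallyKummerFaithful.units` + `IsKummerFaithful.abelianVariety`.  The finite-torsion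
  input is where print's "semi-abelian" generality costs something (true over sub-`p`-adic `k'`; NOT automatic).
* `DivisibleElementsTrivial.pi` — (a) for a product of groups (used for `(Lˣ)^r`).

Refereed pre-IUT material; no Prop-valued fact is introduced; nothing here bears on the disputed [IUTchIII]
Cor. 3.12; typed ≠ endorsed.
-/

noncomputable section

namespace Literature.AnabelianGeometry.AbsoluteAnabelian.AbsTopIII

universe u

open Literature.AlgebraicGeometry.Motives

/-! ### Condition (a) for products -/

/-- Condition (a) of [AbsTopIII] Def. 1.5 p. 32 ("`⋂_{N ≥ 1} N · A = {0}`") for a product of groups: if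
every factor has no nontrivial infinitely divisible element, neither has the product (coordinatewise).
[cite: MochizukiAbsTopIII2015, Def 1.5 (a) p.32] -/
theorem DivisibleElementsTrivial.pi {ι : Type*} {G : ι → Type*} [∀ i, CommGroup (G i)]
    (h : ∀ i, DivisibleElementsTrivial (G i)) : DivisibleElementsTrivial (∀ i, G i) := by
  refine ⟨fun x hx => funext fun i => ?_⟩
  refine (h i).eq_one_of_forall_exists_pow (x i) fun n hn => ?_
  obtain ⟨y, hy⟩ := hx n hn
  exact ⟨y i, by rw [← Pi.pow_apply, hy]⟩

/-! ### The points-level semi-abelian datum -/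

/-- **HYPOTHESIS PACKAGE — the semi-abelian case of [AbsTopIII] Def. 1.5 p. 32 at the level of points**
(«shadow of the semi-abelian case»; NOT a definition of semi-abelian varieties, which the tree does not
have as group schemes — typing debt E-L4-11).  The data a semi-abelian variety `0 → T → A → B → 0` over
`k'` induces on `k'`-points: the group `P = A(k')`, the abelian quotient `B`, the map `A(k') → B(k')`, and
an embedding of its kernel `T(k')` (left exactness of points) into the points `(Lˣ)^r` of the split torus
over a finite extension `L / k'` splitting `T`. [cite: MochizukiAbsTopIII2015, Def 1.5 p.32] -/
structure SemiAbelianPointsDatum (k' : Type u) [Field k'] (P : Type u) [CommGroup P]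
    (B : AbelianVariety k') : Type u where
  /-- the map on `k'`-points "`A(k') → B(k')`" to the points of the abelian quotient "`B = A / T`" (a genuine
  `k'`-group scheme of the tree) -/
  toQuotient : P →* B.Points k'
  /-- the torus part "`T(k') = Ker (A(k') → B(k'))`" embeds in the split-torus points `(Lˣ)^r` over some
  finite extension `L / k'` ("`T(k') ⊆ T(L) ≅ (Lˣ)^r`", `L` splitting `T`) -/
  torus_splits : ∃ (L : Type u) (_ : Field L) (_ : Algebra k' L), Module.Finite k' L ∧
    ∃ (r : ℕ) (ι : toQuotient.ker →* (Fin r → Lˣ)), Function.Injective ι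

namespace SemiAbelianPointsDatum

variable {k' : Type u} [Field k']

/-- NON-VACUITY / the abelian-variety extreme: an abelian variety `B / k'` is a semi-abelian datum on
`P = B(k')` with trivial torus part (the quotient map the identity, `L = k'`, rank `0`).
[cite: MochizukiAbsTopIII2015, Def 1.5 p.32] -/
def ofAbelianVariety (B : AbelianVariety k') : SemiAbelianPointsDatum k' (B.Points k') B where
  toQuotient := MonoidHom.id _
  torus_splits := ⟨k', inferInstance, inferInstance, inferInstance, 0, 1, fun a b _ =>
    Subtype.ext (((MonoidHom.id _).mem_ker.mp a.2).trans ((MonoidHom.id _).mem_ker.mp b.2).symm)⟩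

/-- The torus part of a semi-abelian datum over a finite extension `k'` of a TORALLY Kummer-faithful `k`
satisfies (a): `T(k') ↪ (Lˣ)^r` with `L / k` finite, and `⋂_N (Lˣ)^N = {1}` (Def. 1.5, torus clause;
Rmk. 1.5.2 splitting). [cite: MochizukiAbsTopIII2015, Def 1.5 p.32] -/
theorem divisibleElementsTrivial_ker {k : Type u} [Field k] (hk : IsTorallyKummerFaithful k)
    [Algebra k k'] [Module.Finite k k'] {P : Type u} [CommGroup P] {B : AbelianVariety k'}
    (D : SemiAbelianPointsDatum k' P B) : DivisibleElementsTrivial D.toQuotient.ker := by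
  obtain ⟨L, _, _, _, r, ι, hι⟩ := D.torus_splits
  letI : Algebra k L := ((algebraMap k' L).comp (algebraMap k k')).toAlgebra
  haveI : IsScalarTower k k' L := IsScalarTower.of_algebraMap_eq fun _ => rfl
  haveI : Module.Finite k L := Module.Finite.trans k' L
  exact DivisibleElementsTrivial.of_injective_monoidHom ι hι
    (DivisibleElementsTrivial.pi fun _ => hk.units L inferInstance)

/-- **[AbsTopIII] Def. 1.5, semi-abelian case at the level of points, from the tree predicate**: if `k`
is Kummer-faithful (tori + abelian varieties, `IsKummerFaithful`), `k' / k` is finite, and the abelian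
quotient `B` of a semi-abelian datum on `P` over `k'` has FINITE torsion in `B(k')`, then `P` ("`A(k')`")
satisfies (a) `⋂_N N · A(k') = {0}` — the dévissage `DivisibleElementsTrivial.of_extension_of_finite_torsion`
along `0 → T(k') → A(k') → B(k')`. [cite: MochizukiAbsTopIII2015, Def 1.5 p.32] -/
theorem divisibleElementsTrivial_of_isKummerFaithful {k : Type u} [Field k] (hk : IsKummerFaithful k)
    [Algebra k k'] [Module.Finite k k'] {P : Type u} [CommGroup P] {B : AbelianVariety k'}
    (D : SemiAbelianPointsDatum k' P B) [Finite (CommGroup.torsion (B.Points k'))] :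
    DivisibleElementsTrivial P :=
  DivisibleElementsTrivial.of_extension_of_finite_torsion D.toQuotient.ker.subtype D.toQuotient
    D.toQuotient.ker.subtype_injective (by rw [Subgroup.range_subtype])
    (D.divisibleElementsTrivial_ker hk.torally) (hk.abelianVariety k' inferInstance B)

/-- The same with the finite-torsion input in bounded-exponent form: some `M ≥ 1` kills every torsion point
of `B(k')`. [cite: MochizukiAbsTopIII2015, Def 1.5 p.32] -/
theorem divisibleElementsTrivial_of_isKummerFaithful_of_pow_eq_one {k : Type u} [Field k]
    (hk : IsKummerFaithful k) [Algebra k k'] [Module.Finite k k'] {P : Type u} [CommGroup P]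
    {B : AbelianVariety k'} (D : SemiAbelianPointsDatum k' P B)
    {M : ℕ} (hM : 0 < M) (htors : ∀ b : B.Points k', IsOfFinOrder b → b ^ M = 1) :
    DivisibleElementsTrivial P :=
  DivisibleElementsTrivial.of_extension D.toQuotient.ker.subtype D.toQuotient
    D.toQuotient.ker.subtype_injective (by rw [Subgroup.range_subtype]) hM htors
    (D.divisibleElementsTrivial_ker hk.torally) (hk.abelianVariety k' inferInstance B)

end SemiAbelianPointsDatum

end Literature.AnabelianGeometry.AbsoluteAnabelian.AbsTopIII

end
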